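import Literature.MathematicalPhysics.QuantumFieldTheory.Balaban1983to89.B5G183RateWThetaMixedSharp

/-!
# B5G183RateWThetaCentre — order two, `U = 1`: NO eta-rate `N^{−γ}` with `γ > 1`, for ANY King power
`θ` (`d ≥ 2`); the complete exponent laws `min(2θ,1)` and `min(4θ,1)`

[cite: Balaban1984PropagatorsI, Prop. 1.1 (1.89) p.33, (1.83)–(1.84) p.31, (1.87) p.32; King1986,
(4.19)–(4.20), (4.23) p.672, (4.24) p.673] [folklore]

Bałaban, *Propagators and renormalization transformations for lattice gauge theories. I*, CMP 95
(1984), p.33: «Proposition 1.1. The operator G is a symmetric operator on L²(T_η) and ‖GJ‖, ‖∇GJ‖,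
‖G∇*J‖, ‖∇G∇*J‖, ‖∇∇GJ‖, ‖G∇*∇*J‖ ≤ γ₀⁻¹‖J‖, (1.89) with a positive constant γ₀ independent of k,
T_η, and depending on d only (if we put a = 1).»  p.31 prints the propagator `G(p′) = Δ_a⁻¹` per fibre
as (1.83) with `φ_μ(p′)` (1.84), and p.32 the cancellation (1.87) of the `l′ = l` terms.  Bałaban
prints NO rate in `η = L^{−k}`; the eta-rate currencies of this directory (`OrderTwoOpRateResidualWθ`,
`OrderTwoOpRateResidualWθoff`, `OrderTwoOpRateResidualW1`) and every constant below are OURS (finite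
torus, `U = 1`, the linear theory only).  King [King1986], CMP 102 (1986) 649–677, (4.20) p.672 supplies the alias weight
`W = ∏_μ |p′_μ|/|p′_μ + 2πj_μ|` whose real power `W^θ` multiplies each derivative symbol; at the zone
CENTRE `l = 0` the weight is `1` for every `θ` (`B5G183RateWgtPieces.wθdSym_centre`).

WHAT IS PROVED.  For `d ≥ 2` (two distinct directions `μ₁ ≠ μ₂`), `a > 0`, EVERY real `θ` and EVERY
constant `C`: the order-two residuals have no rate `N^{−γ}` with `γ > 1` —
`not_orderTwoOpRateResidualWθoff_of_one_lt`, `not_orderTwoOpRateResidualWθ_of_one_lt`,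
`not_orderTwoOpRateResidualW1_of_one_lt`.  With the landed positive and sharpness halves this
COMPLETES the exponent laws on `0 ≤ θ ≤ 1` (`d ≥ 2`):
`(∃ C, OrderTwoOpRateResidualWθ d a C θ γ) ↔ γ ≤ min(2θ,1)` (`orderTwoOpRateWθ_law`),
`(∃ C, OrderTwoOpRateResidualWθoff d a C θ γ) ↔ γ ≤ min(4θ,1)` (`orderTwoOpRateWθoff_law`),
`(∃ C, OrderTwoOpRateResidualW1 d a C γ) ↔ γ ≤ 1` (`orderTwoOpRateW1_law`).

WITNESS (θ-blind).  `R = 2`, fibre `p′ = π e_{μ₁} + (π/2) e_{μ₂}`, derivative pair `(∂_{μ₁}, ∂_{μ₂})`,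
the CENTRE class `l = 0` (paired with itself at both levels, King weight `1`), polarisation entry
`((0,μ₁),(0,μ₁))`.  By (1.83)–(1.84) and (1.87) the centre diagonal entry of `G^{(n)}(p′)` is the REAL
number `g_n = (1 + aS₁)/(φ_{μ₁}Δ(p′)) + |b(0,μ₁)|²/(aΦ) ≥ 1/(Δ(p′) + a) ≥ 1/(π²d + a)` (`G_centre`,
`gC_ge`), and the two centre derivative symbols contribute `∂_{μ₁}(p′)·conj ∂_{μ₂}(p′) =
4n² sin(p′_{μ₁}/2n) sin(p′_{μ₂}/2n)·e^{i(p′_{μ₁} − p′_{μ₂})/(2n)}` (`dSym_centre_mul_conj`): the entry is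
`P_n e^{iπ/(4n)}` with `P_n ≥ 2/(π²d + a)` (Jordan's inequality), so the PHASES of the level-`2N` and
level-`N` entries differ by `π/(8N)` and `|P_{2N}e^{iπ/8N} − P_N e^{iπ/4N}| ≥ P_N sin(π/8N) ≥
(1/(π²d + a))/(2N)` (`polar_diff_lower`) — a `1/N` LOWER bound that no `C/N^γ`, `γ > 1`, can dominate
(`numeric_core1`).  In equal directions `ν = ν′` this phase is absent (the centre entry is then real
and second-order close), which is why two distinct directions are used.

NOT CLAIMED: `d = 1`; the value of the `1/N` coefficient; anything about `p′`-derivatives, `∫dp′`,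
decay, `U ≠ 1`, constants.  NOT summit progress.
-/

noncomputable section

namespace Literature.MathematicalPhysics.QuantumFieldTheory.Balaban1983to89.B5G183RateWThetaCentre

open scoped BigOperators ComplexConjugate Matrix.Norms.L2Operator
open Finset Complex
open Literature.MathematicalPhysics.QuantumFieldTheory.Balaban1983to89.B4Strip
open Literature.MathematicalPhysics.QuantumFieldTheory.Balaban1983to89.B5Prop11Fiber
open Literature.MathematicalPhysics.QuantumFieldTheory.Balaban1983to89.B5Prop11Bound
open Literature.MathematicalPhysics.QuantumFieldTheory.Balaban1983to89.B5Hk163Rate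
open Literature.MathematicalPhysics.QuantumFieldTheory.Balaban1983to89.B5Hk163RateSum
open Literature.MathematicalPhysics.QuantumFieldTheory.Balaban1983to89.B5G183Rate
open Literature.MathematicalPhysics.QuantumFieldTheory.Balaban1983to89.B5G183RateOp
open Literature.MathematicalPhysics.QuantumFieldTheory.Balaban1983to89.B5G183RateO2Diag
open Literature.MathematicalPhysics.QuantumFieldTheory.Balaban1983to89.B5G183RateO2Op
open Literature.MathematicalPhysics.QuantumFieldTheory.Balaban1983to89.B5G183RateW1RankOne
open Literature.MathematicalPhysics.QuantumFieldTheory.Balaban1983to89.B5G183RateWgtPieces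
open Literature.MathematicalPhysics.QuantumFieldTheory.Balaban1983to89.B5G183RateWTheta
open Literature.MathematicalPhysics.QuantumFieldTheory.Balaban1983to89.B5G183RateWThetaSharp
open Literature.MathematicalPhysics.QuantumFieldTheory.Balaban1983to89.B5G183RateWThetaHolds
open Literature.MathematicalPhysics.QuantumFieldTheory.Balaban1983to89.B5G183RateWThetaMixed
open Literature.MathematicalPhysics.QuantumFieldTheory.Balaban1983to89.B5G183RateWThetaMixedSharp
open Literature.MathematicalPhysics.QuantumFieldTheory.King1986
open Literature.Computability.QuantumComplexity.SolovayKitaev (norm_apply_le_norm)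

variable {d : ℕ}

/-! ## §1 The centre diagonal entry of (1.83) is real and bounded below [folklore] -/

section FiberCentre

variable {Λ : Type*} [Fintype Λ] [DecidableEq Λ] (F : Fiber Λ d)

/-- the real number `g = (1 + aS₁(μ))/(φ_μ(p′)Δ(p′)) + |b(0,μ)|²/(aΦ(p′))`: the `((0,μ),(0,μ))` entry of
the fibre matrix (1.83) after the cancellation (1.87). [cite: Balaban1984PropagatorsI, (1.83) p.31,
(1.87) p.32] [folklore] -/
def gC (μ : Fin d) : ℝ :=
  (1 + F.a * F.S₁ μ) / (F.φ μ * F.Δ F.o) + ‖F.b F.o μ‖ ^ 2 / (F.a * F.Φ)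

/-- **the centre diagonal entry of `G` (1.83) is the real number `g`** ((1.87) for the diagonal part,
`b·conj b = |b|²` for the rank-one part). [cite: Balaban1984PropagatorsI, (1.83) p.31, (1.87) p.32]
[folklore] -/
theorem G_centre (μ : Fin d) : F.G (F.o, μ) (F.o, μ) = ((gC F μ : ℝ) : ℂ) := by
  have key := F.O00 μ
  have hb := Complex.mul_conj' (F.b F.o μ)
  simp only [Fiber.G, if_true]
  rw [gC, Fiber.cT]
  push_cast
  linear_combination key + (1 / ((F.a : ℂ) * (F.Φ : ℂ))) * hb

/-- `φ_μ Δ(p′) = Δ(p′) + a|u(p′)v_μ(p′)|² + aS₁Δ(p′)` ((1.84) split at `l″ = 0`). [folklore] -/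
theorem φΔ_eq (μ : Fin d) :
    F.φ μ * F.Δ F.o = F.Δ F.o + F.a * ‖F.u F.o * F.v μ F.o‖ ^ 2 + F.a * F.S₁ μ * F.Δ F.o := by
  have hΔ' : F.Δ F.o ≠ 0 := F.Δo_pos.ne'
  rw [F.φ_eq μ]
  field_simp
  ring

/-- **lower bound of the centre entry: `g ≥ 1/(Δ(p′) + a)`** (`|u v_μ| ≤ 1`, `S₁ ≥ 0`, the rank-one
part is `≥ 0`). [folklore] -/
theorem gC_ge (μ : Fin d) : 1 / (F.Δ F.o + F.a) ≤ gC F μ := by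
  have ha := F.a_pos
  have hΔ := F.Δo_pos
  have hφ := F.φ_pos μ
  have hΦ := F.Φ_pos
  have hS := F.S₁_nonneg μ
  have huv : ‖F.u F.o * F.v μ F.o‖ ^ 2 ≤ 1 := by
    have h1 : ‖F.u F.o * F.v μ F.o‖ ≤ 1 := by
      rw [norm_mul]
      calc ‖F.u F.o‖ * ‖F.v μ F.o‖ ≤ 1 * 1 :=
            mul_le_mul (F.norm_u_le F.o) (F.norm_v_le μ F.o) (norm_nonneg _) zero_le_one
        _ = 1 := one_mul 1
    exact pow_le_one₀ (norm_nonneg _) h1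
  have hkey := φΔ_eq F μ
  have h1 : 1 / (F.Δ F.o + F.a) ≤ (1 + F.a * F.S₁ μ) / (F.φ μ * F.Δ F.o) := by
    rw [div_le_div_iff₀ (by positivity) (by positivity)]
    have h2 : 0 ≤ F.a * F.a * F.S₁ μ := mul_nonneg (mul_nonneg ha.le ha.le) hS
    nlinarith
  have h2 : 0 ≤ ‖F.b F.o μ‖ ^ 2 / (F.a * F.Φ) := by positivity
  rw [gC]
  linarith

/-- `g > 0`. [folklore] -/
theorem gC_pos (μ : Fin d) : 0 < gC F μ :=
  lt_of_lt_of_le (by have := F.a_pos; have := F.Δo_pos; positivity) (gC_ge F μ)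

end FiberCentre

/-! ## §2 The centre entry of the `W^θ∂_ν ⊗ W^θ∂_{ν′}` sandwich in polar form [folklore] -/

section Polar

/-- half-angle: `e^{2ix} − 1 = 2i sin x · e^{ix}`. [folklore] -/
theorem exp_mul_I_sub_one (x : ℝ) :
    Complex.exp (((2 * x : ℝ) : ℂ) * I) - 1
      = 2 * (Real.sin x : ℂ) * I * Complex.exp ((x : ℂ) * I) := by
  have h2 : (((2 * x : ℝ) : ℂ) * I) = (2 * (x : ℂ)) * I := by push_cast; ring
  rw [h2, Complex.exp_mul_I, Complex.exp_mul_I, Complex.cos_two_mul, Complex.sin_two_mul,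
    ← Complex.ofReal_sin, ← Complex.ofReal_cos]
  have h := Real.sin_sq_add_cos_sq x
  have h' : ((Real.sin x : ℝ) : ℂ) ^ 2 + ((Real.cos x : ℝ) : ℂ) ^ 2 = 1 := by exact_mod_cast h
  linear_combination (2 : ℂ) * h' - (2 : ℂ) * ((Real.sin x : ℝ) : ℂ) ^ 2 * Complex.I_sq

/-- `conj e^{ix} = e^{−ix}` for real `x`. [folklore] -/
theorem conj_exp_mul_I (x : ℝ) : conj (Complex.exp ((x : ℂ) * I)) = Complex.exp (-((x : ℂ) * I)) := by
  rw [← Complex.exp_conj, map_mul, Complex.conj_ofReal, Complex.conj_I, mul_neg]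

/-- polar form of `n(e^{2iα} − 1) · conj(n(e^{2iβ} − 1)) = 4n² sin α sin β · e^{i(α − β)}`. [folklore] -/
theorem prod_polar (n α β : ℝ) :
    ((n : ℂ) * (Complex.exp (((2 * α : ℝ) : ℂ) * I) - 1))
      * conj ((n : ℂ) * (Complex.exp (((2 * β : ℝ) : ℂ) * I) - 1))
      = ((4 * n ^ 2 * Real.sin α * Real.sin β : ℝ) : ℂ) * Complex.exp (((α - β : ℝ) : ℂ) * I) := by
  rw [exp_mul_I_sub_one, exp_mul_I_sub_one]
  simp only [map_mul, Complex.conj_ofReal, Complex.conj_I, map_ofNat, conj_exp_mul_I]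
  have e : Complex.exp (((α - β : ℝ) : ℂ) * I)
      = Complex.exp ((α : ℂ) * I) * Complex.exp (-((β : ℂ) * I)) := by
    rw [← Complex.exp_add]; congr 1; push_cast; ring
  have hc : ((4 * n ^ 2 * Real.sin α * Real.sin β : ℝ) : ℂ)
      = 4 * (n : ℂ) ^ 2 * ((Real.sin α : ℝ) : ℂ) * ((Real.sin β : ℝ) : ℂ) := by
    simp only [Complex.ofReal_mul, Complex.ofReal_pow, Complex.ofReal_ofNat]
  rw [e, hc]
  linear_combination (-4 * (n : ℂ) ^ 2 * ((Real.sin α : ℝ) : ℂ) * ((Real.sin β : ℝ) : ℂ)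
    * Complex.exp ((α : ℂ) * I) * Complex.exp (-((β : ℂ) * I))) * Complex.I_mul_I

/-- the centre derivative symbol: `∂^{(n)}_ν(p′) = n(e^{2i·p′_ν/(2n)} − 1)`. [folklore] -/
theorem dSym_centre_eq (n : ℕ) [NeZero n] (s : Fin d → ℝ) (ν : Fin d) :
    dSym n (0 : Fin d → Fin n) s ν
      = ((n : ℝ) : ℂ) * (Complex.exp (((2 * (s ν / (2 * n)) : ℝ) : ℂ) * I) - 1) := by
  have hn0 : (n : ℝ) ≠ 0 := Nat.cast_ne_zero.mpr (NeZero.ne n)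
  have hsh : shiftr n (0 : Fin d → Fin n) s ν = s ν := by simp [shiftr]
  have h2 : 2 * (s ν / (2 * n)) = s ν / n := by field_simp
  unfold dSym
  rw [hsh, h2]
  push_cast
  ring

/-- **`∂^{(n)}_ν(p′)·conj ∂^{(n)}_{ν′}(p′) = 4n² sin(p′_ν/2n) sin(p′_{ν′}/2n)·e^{i(p′_ν − p′_{ν′})/(2n)}`**
at the zone centre. [folklore] -/
theorem dSym_centre_mul_conj (n : ℕ) [NeZero n] (s : Fin d → ℝ) (ν ν' : Fin d) :
    dSym n (0 : Fin d → Fin n) s ν * conj (dSym n (0 : Fin d → Fin n) s ν')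
      = ((4 * (n : ℝ) ^ 2 * Real.sin (s ν / (2 * n)) * Real.sin (s ν' / (2 * n)) : ℝ) : ℂ)
          * Complex.exp ((((s ν / (2 * n) - s ν' / (2 * n)) : ℝ) : ℂ) * I) := by
  rw [dSym_centre_eq n s ν, dSym_centre_eq n s ν']
  exact prod_polar (n : ℝ) _ _

/-- **the `((0,μ),(0,μ))` entry of the `W^θ∂_ν ⊗ W^θ∂_{ν′}` sandwich of `G^{(n)}(p′)` is
`P·e^{i(p′_ν − p′_{ν′})/(2n)}` with the REAL amplitude `P = 4n² sin(p′_ν/2n) sin(p′_{ν′}/2n)·g`**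
(King weight `1` at the centre for every `θ`). [cite: Balaban1984PropagatorsI, (1.83) p.31, (1.87)
p.32; King1986, (4.20) p.672] [folklore] -/
theorem sandwich_centre_entry {n : ℕ} [NeZero n] (hn : 1 ≤ n) (a : ℝ) (ha : 0 < a) (θ : ℝ)
    {s : Fin d → ℝ} (hs : ∀ ν, |s ν| ≤ Real.pi) (hs0 : s ≠ 0) (ν ν' μ : Fin d) :
    sandwich (fun K => wθdSym n θ K s ν) (fun K => wθdSym n θ K s ν')
        (balabanFiber n hn a ha s hs hs0).G ((0 : Fin d → Fin n), μ) ((0 : Fin d → Fin n), μ)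
      = ((4 * (n : ℝ) ^ 2 * Real.sin (s ν / (2 * n)) * Real.sin (s ν' / (2 * n))
            * gC (balabanFiber n hn a ha s hs hs0) μ : ℝ) : ℂ)
          * Complex.exp ((((s ν / (2 * n) - s ν' / (2 * n)) : ℝ) : ℂ) * I) := by
  have hG : (balabanFiber n hn a ha s hs hs0).G ((0 : Fin d → Fin n), μ) ((0 : Fin d → Fin n), μ)
      = ((gC (balabanFiber n hn a ha s hs hs0) μ : ℝ) : ℂ) :=
    G_centre (balabanFiber n hn a ha s hs hs0) μ
  simp only [sandwich]
  rw [wθdSym_centre hn θ hs ν, wθdSym_centre hn θ hs ν', hG,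
    mul_right_comm, dSym_centre_mul_conj n s ν ν']
  push_cast
  ring

/-- **lower bound for a difference of two complex numbers in polar form:**
`|P₂e^{iφ₂} − P₁e^{iφ₁}| ≥ P₁ sin(φ₁ − φ₂)` (`P₁ ≥ 0`, `0 ≤ φ₁ − φ₂ ≤ π`; rotate by `e^{−iφ₂}` and take
the imaginary part). [folklore] -/
theorem polar_diff_lower {P₁ P₂ φ₁ φ₂ : ℝ} (hP₁ : 0 ≤ P₁) (hψ0 : 0 ≤ φ₁ - φ₂) (hψ1 : φ₁ - φ₂ ≤ Real.pi) :
    P₁ * Real.sin (φ₁ - φ₂)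
      ≤ ‖((P₂ : ℝ) : ℂ) * Complex.exp (((φ₂ : ℝ) : ℂ) * I)
          - ((P₁ : ℝ) : ℂ) * Complex.exp (((φ₁ : ℝ) : ℂ) * I)‖ := by
  set X := ((P₂ : ℝ) : ℂ) * Complex.exp (((φ₂ : ℝ) : ℂ) * I)
    - ((P₁ : ℝ) : ℂ) * Complex.exp (((φ₁ : ℝ) : ℂ) * I) with hXd
  have hrot : X * Complex.exp ((((-φ₂ : ℝ)) : ℂ) * I)
      = ((P₂ : ℝ) : ℂ) - ((P₁ : ℝ) : ℂ) * Complex.exp ((((φ₁ - φ₂ : ℝ)) : ℂ) * I) := by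
    rw [hXd, sub_mul, mul_assoc, mul_assoc, ← Complex.exp_add, ← Complex.exp_add]
    have e1 : ((φ₂ : ℝ) : ℂ) * I + (((-φ₂ : ℝ)) : ℂ) * I = 0 := by push_cast; ring
    have e2 : ((φ₁ : ℝ) : ℂ) * I + (((-φ₂ : ℝ)) : ℂ) * I = (((φ₁ - φ₂ : ℝ)) : ℂ) * I := by
      push_cast; ring
    rw [e1, e2, Complex.exp_zero, mul_one]
  have hnorm : ‖X‖ = ‖X * Complex.exp ((((-φ₂ : ℝ)) : ℂ) * I)‖ := by
    rw [norm_mul, Complex.norm_exp_ofReal_mul_I, mul_one]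
  have him : (((P₂ : ℝ) : ℂ) - ((P₁ : ℝ) : ℂ) * Complex.exp ((((φ₁ - φ₂ : ℝ)) : ℂ) * I)).im
      = -(P₁ * Real.sin (φ₁ - φ₂)) := by
    rw [Complex.sub_im, Complex.ofReal_im, Complex.mul_im, Complex.ofReal_re, Complex.ofReal_im,
      Complex.exp_ofReal_mul_I_im, zero_mul, add_zero, zero_sub]
  have hsin : 0 ≤ Real.sin (φ₁ - φ₂) := Real.sin_nonneg_of_nonneg_of_le_pi hψ0 hψ1
  calc P₁ * Real.sin (φ₁ - φ₂) = |(((P₂ : ℝ) : ℂ) - ((P₁ : ℝ) : ℂ)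
          * Complex.exp ((((φ₁ - φ₂ : ℝ)) : ℂ) * I)).im| := by
        rw [him, abs_neg, abs_of_nonneg (mul_nonneg hP₁ hsin)]
    _ ≤ ‖((P₂ : ℝ) : ℂ) - ((P₁ : ℝ) : ℂ) * Complex.exp ((((φ₁ - φ₂ : ℝ)) : ℂ) * I)‖ :=
        Complex.abs_im_le_norm _
    _ = ‖X‖ := by rw [hnorm, hrot]

end Polar

/-! ## §3 The witness: fibre `π e_{μ₁} + (π/2) e_{μ₂}`, centre class, `R = 2` [folklore] -/

section Witness

/-- the fibre `p′ = π e_{μ₁} + (π/2) e_{μ₂}`. [folklore] -/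
def sCen (μ₁ μ₂ : Fin d) : Fin d → ℝ :=
  fun μ => if μ = μ₁ then Real.pi else if μ = μ₂ then Real.pi / 2 else 0

/-- zone and non-vanishing of the witness fibre. [folklore] -/
theorem sCen_zone_ne_zero (μ₁ μ₂ : Fin d) :
    (∀ ν, |sCen μ₁ μ₂ ν| ≤ Real.pi) ∧ sCen μ₁ μ₂ ≠ 0 := by
  have hπ := Real.pi_pos
  refine ⟨fun ν => ?_, fun h => ?_⟩
  · unfold sCen
    split_ifs
    · rw [abs_of_pos hπ]
    · rw [abs_of_pos (by positivity)]; linarith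
    · rw [abs_zero]; exact hπ.le
  · have h1 := congrFun h μ₁
    simp only [sCen, if_true, Pi.zero_apply] at h1
    exact hπ.ne' h1

/-- `p′_{μ₁} = π`. [folklore] -/
theorem sCen_fst (μ₁ μ₂ : Fin d) : sCen μ₁ μ₂ μ₁ = Real.pi := by simp [sCen]

/-- `p′_{μ₂} = π/2` (`μ₁ ≠ μ₂`). [folklore] -/
theorem sCen_snd {μ₁ μ₂ : Fin d} (hne : μ₁ ≠ μ₂) : sCen μ₁ μ₂ μ₂ = Real.pi / 2 := by
  simp [sCen, hne.symm]

/-- the planted order-two `W^θ` difference at the witness: `R = 2`, level `N = M + 2`, fibre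
`π e_{μ₁} + (π/2) e_{μ₂}`, derivative directions `(μ₁, μ₂)`. [folklore] -/
def XC (M : ℕ) [NeZero (M + 2)] (μ₁ μ₂ : Fin d) (a : ℝ) (ha : 0 < a) (θ : ℝ) :
    Matrix ((Fin d → Fin (2 * (M + 2))) × Fin d) ((Fin d → Fin (2 * (M + 2))) × Fin d) ℂ :=
  sandwich (fun K => wθdSym (2 * (M + 2)) θ K (sCen μ₁ μ₂) μ₁)
      (fun K => wθdSym (2 * (M + 2)) θ K (sCen μ₁ μ₂) μ₂)
      (balabanFiber (2 * (M + 2)) (by omega) a ha (sCen μ₁ μ₂) (sCen_zone_ne_zero μ₁ μ₂).1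
        (sCen_zone_ne_zero μ₁ μ₂).2).G
    - plant 2 (sCen μ₁ μ₂) (sandwich (fun k => wθdSym (M + 2) θ k (sCen μ₁ μ₂) μ₁)
        (fun k => wθdSym (M + 2) θ k (sCen μ₁ μ₂) μ₂)
        (balabanFiber (M + 2) (by omega) a ha (sCen μ₁ μ₂) (sCen_zone_ne_zero μ₁ μ₂).1
          (sCen_zone_ne_zero μ₁ μ₂).2).G)

/-- an `OrderTwoOpRateResidualWθoff` bound specialised to the witness (`μ₁ ≠ μ₂`). [folklore] -/
theorem opNorm_XC_le {a C θ γ : ℝ} (h : OrderTwoOpRateResidualWθoff d a C θ γ) (M : ℕ)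
    [NeZero (M + 2)] {μ₁ μ₂ : Fin d} (hne : μ₁ ≠ μ₂) (ha : 0 < a) :
    ‖XC M μ₁ μ₂ a ha θ‖ ≤ C / ((M + 2 : ℕ) : ℝ) ^ γ :=
  h (M + 2) 2 (by omega) (by omega) ha (sCen μ₁ μ₂) (sCen_zone_ne_zero μ₁ μ₂).1
    (sCen_zone_ne_zero μ₁ μ₂).2 μ₁ μ₂ hne (by norm_num)

/-- **the centre entry of `XC` in polar form:** `P_{2N} e^{iπ/(8N)} − P_N e^{iπ/(4N)}` — both levels
plant the centre class on itself (`iota_zero`, `plant_iota_iota`). [folklore] -/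
theorem XC_entry (M : ℕ) [NeZero (M + 2)] {μ₁ μ₂ : Fin d} (hne : μ₁ ≠ μ₂) (a : ℝ) (ha : 0 < a)
    (θ : ℝ) :
    XC M μ₁ μ₂ a ha θ ((0 : Fin d → Fin (2 * (M + 2))), μ₁) ((0 : Fin d → Fin (2 * (M + 2))), μ₁)
      = ((4 * ((2 * (M + 2) : ℕ) : ℝ) ^ 2 * Real.sin (Real.pi / (2 * ((2 * (M + 2) : ℕ) : ℝ)))
            * Real.sin (Real.pi / 2 / (2 * ((2 * (M + 2) : ℕ) : ℝ)))
            * gC (balabanFiber (2 * (M + 2)) (by omega) a ha (sCen μ₁ μ₂)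
                (sCen_zone_ne_zero μ₁ μ₂).1 (sCen_zone_ne_zero μ₁ μ₂).2) μ₁ : ℝ) : ℂ)
          * Complex.exp ((((Real.pi / (2 * ((2 * (M + 2) : ℕ) : ℝ))
              - Real.pi / 2 / (2 * ((2 * (M + 2) : ℕ) : ℝ))) : ℝ) : ℂ) * I)
        - ((4 * ((M + 2 : ℕ) : ℝ) ^ 2 * Real.sin (Real.pi / (2 * ((M + 2 : ℕ) : ℝ)))
            * Real.sin (Real.pi / 2 / (2 * ((M + 2 : ℕ) : ℝ)))
            * gC (balabanFiber (M + 2) (by omega) a ha (sCen μ₁ μ₂)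
                (sCen_zone_ne_zero μ₁ μ₂).1 (sCen_zone_ne_zero μ₁ μ₂).2) μ₁ : ℝ) : ℂ)
          * Complex.exp ((((Real.pi / (2 * ((M + 2 : ℕ) : ℝ))
              - Real.pi / 2 / (2 * ((M + 2 : ℕ) : ℝ))) : ℝ) : ℂ) * I) := by
  have hN : 1 ≤ M + 2 := by omega
  have h2N : 1 ≤ 2 * (M + 2) := by omega
  have hs := (sCen_zone_ne_zero μ₁ μ₂).1
  have hs0 := (sCen_zone_ne_zero μ₁ μ₂).2
  have hpl := plant_iota_iota (R := 2) hN hs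
    (sandwich (fun k => wθdSym (M + 2) θ k (sCen μ₁ μ₂) μ₁)
      (fun k => wθdSym (M + 2) θ k (sCen μ₁ μ₂) μ₂)
      (balabanFiber (M + 2) (by omega) a ha (sCen μ₁ μ₂) hs hs0).G) 0 0 μ₁ μ₁
  rw [iota_zero hN hs] at hpl
  unfold XC
  rw [Matrix.sub_apply, hpl, sandwich_centre_entry h2N a ha θ hs hs0 μ₁ μ₂ μ₁,
    sandwich_centre_entry hN a ha θ hs hs0 μ₁ μ₂ μ₁, sCen_fst, sCen_snd hne]

end Witness

/-! ## §4 No rate beyond `1/N`, and the complete exponent laws [folklore] -/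

section NoGo

/-- numeric core: `c/N ≤ C/N^γ` with `γ > 1`, `c > 0` is impossible for `N ≥ (|C|/c + 1)^{1/(γ−1)}`,
`N ≥ 1`. [folklore] -/
theorem numeric_core1 {C c N γ : ℝ} (hN : 1 ≤ N) (hc : 0 < c) (hγ : 1 < γ)
    (hm : c / N ≤ C / N ^ γ) (hT : (|C| / c + 1) ^ (1 / (γ - 1)) ≤ N) : False := by
  have hN0 : 0 < N := by linarith
  set ε := γ - 1 with hεd
  have hε : 0 < ε := by rw [hεd]; linarith
  have hE : 0 < N ^ ε := Real.rpow_pos_of_pos hN0 _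
  have h1 : |C| / c + 1 ≤ N ^ ε := by
    have h0 : 0 ≤ |C| / c + 1 := by positivity
    calc |C| / c + 1 = ((|C| / c + 1) ^ (1 / ε)) ^ ε := by
          rw [← Real.rpow_mul h0, one_div_mul_cancel hε.ne', Real.rpow_one]
      _ ≤ N ^ ε := Real.rpow_le_rpow (Real.rpow_nonneg h0 _) hT hε.le
  have hγsplit : N ^ γ = N * N ^ ε := by
    rw [show γ = 1 + ε by rw [hεd]; ring, Real.rpow_add hN0, Real.rpow_one]
  rw [hγsplit] at hm
  -- c N^ε ≤ C
  have hm' : c * N ^ ε ≤ C := by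
    have h := mul_le_mul_of_nonneg_left hm (by positivity : (0 : ℝ) ≤ N * N ^ ε)
    have e1 : N * N ^ ε * (c / N) = c * N ^ ε := by field_simp
    have e2 : N * N ^ ε * (C / (N * N ^ ε)) = C := by field_simp
    rwa [e1, e2] at h
  have h2 : |C| + c ≤ c * N ^ ε := by
    have := mul_le_mul_of_nonneg_left h1 hc.le
    have e : c * (|C| / c + 1) = |C| + c := by field_simp
    linarith
  linarith [le_abs_self C]

/-- **ORDER TWO, WEIGHTS `W^θ∂_{μ₁} ⊗ W^θ∂_{μ₂}`, MIXED DIRECTIONS: NO eta-rate `N^{−γ}` WITH `γ > 1`,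
for EVERY real `θ`, every constant `C` (`d ≥ 2`, `a > 0`).**  Witness: the CENTRE class at the fibre
`π e_{μ₁} + (π/2) e_{μ₂}` — King's weight is `1` there, the centre diagonal entry of (1.83) is real
and `≥ 1/(π²d + a)`, and the product of the two centre derivative symbols carries the level-dependent
phase `e^{iπ/(4n)}`, so the planted difference has modulus `≥ (1/(π²d + a))/(2N)`.
[cite: Balaban1984PropagatorsI, Prop. 1.1 (1.89) p.33, (1.83)–(1.84) p.31, (1.87) p.32; King1986,
(4.19)–(4.20), (4.23) p.672] [folklore] -/
theorem not_orderTwoOpRateResidualWθoff_of_one_lt {μ₁ μ₂ : Fin d} (hne : μ₁ ≠ μ₂) (a : ℝ)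
    (ha : 0 < a) (θ : ℝ) {C γ : ℝ} (hγ : 1 < γ) : ¬ OrderTwoOpRateResidualWθoff d a C θ γ := by
  intro h
  have hπ := Real.pi_pos
  have hd1 : (1 : ℝ) ≤ d := by
    have : 1 ≤ d := by
      rcases Nat.lt_or_ge 0 d with h0 | h0
      · omega
      · exact absurd (Fin.pos μ₁) (by omega)
    exact_mod_cast this
  -- the θ-blind constant
  set g₀ : ℝ := 1 / (Real.pi ^ 2 * d + a) with hg₀
  have hg₀pos : 0 < g₀ := by positivity
  have hc : 0 < g₀ / 2 := by positivity
  obtain ⟨M, hM⟩ := exists_nat_ge ((|C| / (g₀ / 2) + 1) ^ (1 / (γ - 1)))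
  haveI : NeZero (M + 2) := ⟨by omega⟩
  have hN : 1 ≤ M + 2 := by omega
  have hM0 : (0 : ℝ) ≤ M := Nat.cast_nonneg M
  have hNM : ((M + 2 : ℕ) : ℝ) = (M : ℝ) + 2 := by push_cast; ring
  have hN1 : (1 : ℝ) ≤ ((M + 2 : ℕ) : ℝ) := by rw [hNM]; linarith
  have hN0 : (0 : ℝ) < ((M + 2 : ℕ) : ℝ) := by linarith
  have hT : (|C| / (g₀ / 2) + 1) ^ (1 / (γ - 1)) ≤ ((M + 2 : ℕ) : ℝ) := by rw [hNM]; linarith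
  set Nr : ℝ := ((M + 2 : ℕ) : ℝ) with hNr
  have h2Nr : ((2 * (M + 2) : ℕ) : ℝ) = 2 * Nr := by rw [hNr]; push_cast; ring
  have hs := (sCen_zone_ne_zero μ₁ μ₂).1
  have hs0 := (sCen_zone_ne_zero μ₁ μ₂).2
  -- the fibre data at the two levels
  set F₁ := balabanFiber (M + 2) (by omega) a ha (sCen μ₁ μ₂) hs hs0 with hF₁
  set F₂ := balabanFiber (2 * (M + 2)) (by omega) a ha (sCen μ₁ μ₂) hs hs0 with hF₂
  -- lower bound of the level-N centre entry g ≥ g₀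
  have hg₁ : g₀ ≤ gC F₁ μ₁ := by
    have h1 := gC_ge F₁ μ₁
    have h2 := F₁.Δo_le_4dκ
    have hκ : F₁.κ = Real.pi ^ 2 / 4 := rfl
    have haF : F₁.a = a := rfl
    rw [hκ] at h2
    rw [haF] at h1
    refine le_trans ?_ h1
    rw [hg₀]
    apply div_le_div_of_nonneg_left zero_le_one (by have := F₁.Δo_pos; positivity)
    nlinarith
  -- entry ≤ operator norm ≤ C/N^γ
  have hent := (norm_apply_le_norm (XC M μ₁ μ₂ a ha θ)
    ((0 : Fin d → Fin (2 * (M + 2))), μ₁) ((0 : Fin d → Fin (2 * (M + 2))), μ₁)).trans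
    (opNorm_XC_le h M hne ha)
  rw [XC_entry M hne a ha θ] at hent
  simp only [h2Nr] at hent
  rw [← hNr] at hent
  -- the amplitudes and phases
  set P₂ : ℝ := 4 * (2 * Nr) ^ 2 * Real.sin (Real.pi / (2 * (2 * Nr)))
    * Real.sin (Real.pi / 2 / (2 * (2 * Nr))) * gC F₂ μ₁ with hP₂
  set P₁ : ℝ := 4 * Nr ^ 2 * Real.sin (Real.pi / (2 * Nr)) * Real.sin (Real.pi / 2 / (2 * Nr))
    * gC F₁ μ₁ with hP₁
  set φ₂ : ℝ := Real.pi / (2 * (2 * Nr)) - Real.pi / 2 / (2 * (2 * Nr)) with hφ₂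
  set φ₁ : ℝ := Real.pi / (2 * Nr) - Real.pi / 2 / (2 * Nr) with hφ₁
  have hψ : φ₁ - φ₂ = Real.pi / (8 * Nr) := by rw [hφ₁, hφ₂]; field_simp; ring
  -- Jordan's inequality at the three angles
  have hJ1 : 1 / Nr ≤ Real.sin (Real.pi / (2 * Nr)) := by
    have h0 : 0 ≤ Real.pi / (2 * Nr) := by positivity
    have h1 : Real.pi / (2 * Nr) ≤ Real.pi / 2 :=
      div_le_div_of_nonneg_left hπ.le (by norm_num) (by linarith)
    have := Real.mul_le_sin h0 h1
    have e : 2 / Real.pi * (Real.pi / (2 * Nr)) = 1 / Nr := by field_simp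
    linarith
  have hJ2 : 1 / (2 * Nr) ≤ Real.sin (Real.pi / 2 / (2 * Nr)) := by
    have h0 : 0 ≤ Real.pi / 2 / (2 * Nr) := by positivity
    have h1 : Real.pi / 2 / (2 * Nr) ≤ Real.pi / 2 := by
      rw [div_le_iff₀ (by positivity : (0 : ℝ) < 2 * Nr)]; nlinarith
    have := Real.mul_le_sin h0 h1
    have e : 2 / Real.pi * (Real.pi / 2 / (2 * Nr)) = 1 / (2 * Nr) := by field_simp
    linarith
  have hJ3 : 1 / (4 * Nr) ≤ Real.sin (φ₁ - φ₂) := by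
    rw [hψ]
    have h0 : 0 ≤ Real.pi / (8 * Nr) := by positivity
    have h1 : Real.pi / (8 * Nr) ≤ Real.pi / 2 :=
      div_le_div_of_nonneg_left hπ.le (by norm_num) (by linarith)
    have := Real.mul_le_sin h0 h1
    have e : 2 / Real.pi * (Real.pi / (8 * Nr)) = 1 / (4 * Nr) := by field_simp; ring
    linarith
  have hψ0 : 0 ≤ φ₁ - φ₂ := by rw [hψ]; positivity
  have hψ1 : φ₁ - φ₂ ≤ Real.pi := by
    rw [hψ, div_le_iff₀ (by positivity : (0 : ℝ) < 8 * Nr)]; nlinarith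
  -- P₁ ≥ 2 g₀
  have hgpos := gC_pos F₁ μ₁
  have hP₁ge : 2 * g₀ ≤ P₁ := by
    rw [hP₁]
    have hs1 : 0 ≤ Real.sin (Real.pi / (2 * Nr)) := le_trans (by positivity) hJ1
    have hs2 : 0 ≤ Real.sin (Real.pi / 2 / (2 * Nr)) := le_trans (by positivity) hJ2
    calc 2 * g₀ = 4 * Nr ^ 2 * (1 / Nr) * (1 / (2 * Nr)) * g₀ := by field_simp; ring
      _ ≤ 4 * Nr ^ 2 * Real.sin (Real.pi / (2 * Nr)) * Real.sin (Real.pi / 2 / (2 * Nr))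
          * gC F₁ μ₁ := by
          gcongr
  have hP₁0 : 0 ≤ P₁ := le_trans (by positivity) hP₁ge
  -- |entry| ≥ P₁ sin(ψ) ≥ 2g₀/(4N) = (g₀/2)/N
  have hlow := polar_diff_lower (P₂ := P₂) hP₁0 hψ0 hψ1
  have hchain : g₀ / 2 / Nr ≤ C / Nr ^ γ := by
    refine le_trans ?_ (hlow.trans hent)
    calc g₀ / 2 / Nr = 2 * g₀ * (1 / (4 * Nr)) := by field_simp; ring
      _ ≤ P₁ * Real.sin (φ₁ - φ₂) :=
          mul_le_mul hP₁ge hJ3 (by positivity) hP₁0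
  exact numeric_core1 hN1 hc hγ hchain hT

/-- hence no constant works: `¬ ∃ C, OrderTwoOpRateResidualWθoff d a C θ γ` for `γ > 1` (every `θ`,
`d ≥ 2`, `a > 0`). [folklore] -/
theorem no_orderTwoOpRateWθoff_of_one_lt {μ₁ μ₂ : Fin d} (hne : μ₁ ≠ μ₂) (a : ℝ) (ha : 0 < a)
    (θ : ℝ) {γ : ℝ} (hγ : 1 < γ) : ¬ ∃ C, OrderTwoOpRateResidualWθoff d a C θ γ :=
  fun ⟨_, hC⟩ => not_orderTwoOpRateResidualWθoff_of_one_lt hne a ha θ hγ hC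

/-- **ALL DIRECTIONS: NO eta-rate `N^{−γ}` WITH `γ > 1` for the `W^θ∂ ⊗ W^θ∂` residual, every real
`θ`, every `C` (`d ≥ 2`, `a > 0`)** — the all-directions currency contains the mixed pair
(`B5G183RateWThetaMixed.orderTwoOpRateResidualWθoff_of_Wθ`). [cite: Balaban1984PropagatorsI, Prop. 1.1
(1.89) p.33; King1986, (4.19)–(4.20), (4.23) p.672] [folklore] -/
theorem not_orderTwoOpRateResidualWθ_of_one_lt {μ₁ μ₂ : Fin d} (hne : μ₁ ≠ μ₂) (a : ℝ)
    (ha : 0 < a) (θ : ℝ) {C γ : ℝ} (hγ : 1 < γ) : ¬ OrderTwoOpRateResidualWθ d a C θ γ :=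
  fun h => not_orderTwoOpRateResidualWθoff_of_one_lt hne a ha θ hγ
    (orderTwoOpRateResidualWθoff_of_Wθ h)

/-- **KING'S FULL WEIGHT `θ = 1` (`W∂ ⊗ W∂`, `B5G183RateO2Op.OrderTwoOpRateResidualW1`): the rate `1/N`
of `B5G183RateW1RankOne.orderTwoOpRateResidualW1_holds` CANNOT be improved to `N^{−γ}`, `γ > 1`**
(`d ≥ 2`, `a > 0`, every `C`). [cite: Balaban1984PropagatorsI, Prop. 1.1 (1.89) p.33; King1986,
(4.19)–(4.20), (4.23) p.672] [folklore] -/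
theorem not_orderTwoOpRateResidualW1_of_one_lt {μ₁ μ₂ : Fin d} (hne : μ₁ ≠ μ₂) (a : ℝ)
    (ha : 0 < a) (C : ℝ) {γ : ℝ} (hγ : 1 < γ) : ¬ OrderTwoOpRateResidualW1 d a C γ :=
  fun h => not_orderTwoOpRateResidualWθ_of_one_lt hne a ha 1 hγ
    ((orderTwoOpRateResidualWθ_one_iff d a C γ).mpr h)

end NoGo

/-! ## §5 The complete exponent laws on `0 ≤ θ ≤ 1` (`d ≥ 2`) [folklore] -/

section Laws

/-- **THE ALL-DIRECTIONS EXPONENT LAW: `(∃ C, OrderTwoOpRateResidualWθ d a C θ γ) ↔ γ ≤ min(2θ, 1)`**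
for `0 ≤ θ ≤ 1` (`d ≥ 2`, `a > 0`) — `⇐` `B5G183RateWThetaHolds.exists_orderTwoOpRateWθ`; `⇒`:
`γ > 2θ` is excluded by `B5G183RateWThetaSharp.not_orderTwoOpRateResidualWθ_of_lt` (`θ < 1`) and
`γ > 1` by `not_orderTwoOpRateResidualWθ_of_one_lt`. [cite: Balaban1984PropagatorsI, Prop. 1.1 (1.89)
p.33; King1986, (4.19)–(4.20), (4.23) p.672, (4.24) p.673] [folklore] -/
theorem orderTwoOpRateWθ_law {μ₁ μ₂ : Fin d} (hne : μ₁ ≠ μ₂) {a : ℝ} (ha : 0 < a) {θ γ : ℝ}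
    (hθ0 : 0 ≤ θ) (hθ1 : θ ≤ 1) :
    (∃ C, OrderTwoOpRateResidualWθ d a C θ γ) ↔ γ ≤ min (2 * θ) 1 := by
  constructor
  · rintro ⟨C, hC⟩
    by_contra hlt
    rcases min_lt_iff.mp (lt_of_not_ge hlt) with h2 | h1
    · rcases lt_or_ge θ 1 with hθ | hθ
      · exact not_orderTwoOpRateResidualWθ_of_lt μ₁ a ha hθ0 hθ h2 hC
      · exact not_orderTwoOpRateResidualWθ_of_one_lt hne a ha θ (by linarith) hC
    · exact not_orderTwoOpRateResidualWθ_of_one_lt hne a ha θ h1 hC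
  · intro hγ
    exact exists_orderTwoOpRateWθ d ha hθ0 hθ1 hγ

/-- **THE MIXED-DIRECTIONS EXPONENT LAW: `(∃ C, OrderTwoOpRateResidualWθoff d a C θ γ) ↔
γ ≤ min(4θ, 1)`** for `0 ≤ θ ≤ 1` (`d ≥ 2`, `a > 0`) — `⇐`
`B5G183RateWThetaMixed.exists_orderTwoOpRateWθoff`; `⇒`: `γ > 4θ` is excluded by
`B5G183RateWThetaMixedSharp.not_orderTwoOpRateResidualWθoff_of_lt` (`θ < 1/2`) and `γ > 1` by
`not_orderTwoOpRateResidualWθoff_of_one_lt`. [cite: Balaban1984PropagatorsI, Prop. 1.1 (1.89) p.33;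
King1986, (4.19)–(4.20), (4.23) p.672, (4.24) p.673] [folklore] -/
theorem orderTwoOpRateWθoff_law {μ₁ μ₂ : Fin d} (hne : μ₁ ≠ μ₂) {a : ℝ} (ha : 0 < a) {θ γ : ℝ}
    (hθ0 : 0 ≤ θ) (hθ1 : θ ≤ 1) :
    (∃ C, OrderTwoOpRateResidualWθoff d a C θ γ) ↔ γ ≤ min (4 * θ) 1 := by
  constructor
  · rintro ⟨C, hC⟩
    by_contra hlt
    rcases min_lt_iff.mp (lt_of_not_ge hlt) with h4 | h1
    · rcases lt_or_ge θ (1 / 2) with hθ | hθ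
      · exact not_orderTwoOpRateResidualWθoff_of_lt hne a ha hθ0 hθ h4 hC
      · exact not_orderTwoOpRateResidualWθoff_of_one_lt hne a ha θ (by linarith) hC
    · exact not_orderTwoOpRateResidualWθoff_of_one_lt hne a ha θ h1 hC
  · intro hγ
    exact exists_orderTwoOpRateWθoff d ha hθ0 hθ1 hγ

/-- **KING'S FULL WEIGHT: `(∃ C, OrderTwoOpRateResidualW1 d a C γ) ↔ γ ≤ 1`** (`d ≥ 2`, `a > 0`) —
`⇐` `B5G183RateW1RankOne.orderTwoOpRateResidualW1_of_le_one`, `⇒` `not_orderTwoOpRateResidualW1_of_one_lt`.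
[cite: Balaban1984PropagatorsI, Prop. 1.1 (1.89) p.33; King1986, (4.19)–(4.20), (4.23) p.672] [folklore] -/
theorem orderTwoOpRateW1_law {μ₁ μ₂ : Fin d} (hne : μ₁ ≠ μ₂) {a : ℝ} (ha : 0 < a) {γ : ℝ} :
    (∃ C, OrderTwoOpRateResidualW1 d a C γ) ↔ γ ≤ 1 := by
  constructor
  · rintro ⟨C, hC⟩
    by_contra hlt
    exact not_orderTwoOpRateResidualW1_of_one_lt hne a ha C (lt_of_not_ge hlt) hC
  · intro hγ
    exact ⟨CW1op d a, orderTwoOpRateResidualW1_of_le_one d ha hγ⟩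

/-- **summary — the three exponent laws of the order-two `U = 1` eta-rate with King weights**
(`0 ≤ θ ≤ 1`, `d ≥ 2`, `a > 0`): all directions `min(2θ,1)`, mixed directions `min(4θ,1)`, full
weight `1`; in every case the rate `1/N` of the finite-rank pieces is the ceiling. [folklore] -/
theorem exponent_laws {μ₁ μ₂ : Fin d} (hne : μ₁ ≠ μ₂) {a : ℝ} (ha : 0 < a) {θ γ : ℝ}
    (hθ0 : 0 ≤ θ) (hθ1 : θ ≤ 1) :
    ((∃ C, OrderTwoOpRateResidualWθ d a C θ γ) ↔ γ ≤ min (2 * θ) 1)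
      ∧ ((∃ C, OrderTwoOpRateResidualWθoff d a C θ γ) ↔ γ ≤ min (4 * θ) 1)
      ∧ ((∃ C, OrderTwoOpRateResidualW1 d a C γ) ↔ γ ≤ 1) :=
  ⟨orderTwoOpRateWθ_law hne ha hθ0 hθ1, orderTwoOpRateWθoff_law hne ha hθ0 hθ1,
    orderTwoOpRateW1_law hne ha⟩

end Laws

end Literature.MathematicalPhysics.QuantumFieldTheory.Balaban1983to89.B5G183RateWThetaCentre
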